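import Summits.RiemannHypothesis.RiemannHypothesis.Theorems.OddSectorOddOneSignedWindowsEulerLagrange
import Literature.NumberTheory.LFunctions.WeilWindowSimpleEven
import Literature.NumberTheory.LFunctions.WeilOddGroundState
import HarnessLib

/-!
# Two-level proximity for odd-sector Weil ground states
(crux `OddSector.OddOneSignedWindows`, item stmt-RiemannHypothesis-17778, line `SketchIdeator5`,
stub `stub_twoLevelProximity`; RH-free)

The min–max ("two-level") proximity inequality for an operator-free odd-sector ground state
`u` of Weil's windowed quadratic form `Q` (`Literature.NumberTheory.LFunctions.IsWeilOddGroundState a u`,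
energy `ε₁ = ε_od(a) = weilOddGroundEnergy a`): if every `L²`-normalised smooth odd window test `h`
orthogonal to `u` has `Re Q(h) ≥ m₂ > ε₁`, then every normalised smooth odd window test `v` obeys

  `1 − |⟨u, v⟩|² ≤ (Re Q(v) − ε₁) / (m₂ − ε₁)`.

This is the finite-dimensional heart of the second step of the min–max principle (Reed–Simon IV,
Thm XIII.1), written for a form that is only known through minimising sequences. Proof: take the
odd minimising sequence `gₙ → u` of `IsWeilOddGroundState.exists_eulerLagrange` (odd unit window
tests, `Re Q(gₙ) → ε₁`, `∫|gₙ − u|² → 0`, and the weak Euler–Lagrange identity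
`W(gₙ ⋆ h̃) → ε₁ ∫ u h̄` for every window test `h`). With `p = ⟨v, u⟩ = ∫ v ū`,
`cₙ = ⟨gₙ, u⟩ → ⟨u, u⟩ = 1` and `μₙ = −p / cₙ → −p`, the smooth odd window test `wₙ = v + μₙ gₙ`
is EXACTLY orthogonal to `u`, so the hypothesis (un-normalised, `mul_integral_norm_sq_le_re_of_orthogonal`)
gives `m₂ ∫|wₙ|² ≤ Re Q(wₙ)`. Polarisation (`re_weilQuadratic_add_const_mul`, hermitian symmetry
`W(v ⋆ g̃) = conj W(g ⋆ ṽ)`) gives `Re Q(wₙ) = Re Q(v) + |μₙ|² Re Q(gₙ) + 2 Re(μₙ W(gₙ ⋆ ṽ))` and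
`∫|wₙ|² = 1 + |μₙ|² + 2 Re(μ̄ₙ ⟨v, gₙ⟩)`; in the limit `W(gₙ ⋆ ṽ) → ε₁ p̄`, `⟨v, gₙ⟩ → p`,
`Re Q(gₙ) → ε₁`, whence `m₂ (1 − |p|²) ≤ Re Q(v) − ε₁ |p|²` (`twoLevel_limit`), i.e. the claim.

Contents: `re_weilQuadratic_add_const_mul` (polarisation of `Re Q` along a complex line),
`mul_integral_norm_sq_le_re_of_orthogonal` (un-normalising the hypothesis on the orthogonal odd
sphere), `twoLevel_limit` (the limit passage, pure bookkeeping of convergent sequences),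
`twoLevelProximity` (curried form, tree pairing convention `∫ v ū`), and the registered stub
`stub_twoLevelProximity` (verbatim uncurried signature, pairing written `∫ ū v`).

References: M. Reed, B. Simon, *Methods of Modern Mathematical Physics IV*, Thm XIII.1–XIII.2
(min–max); E. Bombieri, Rend. Lincei (9) 11 (2000), §4 Lemma 1 / (4.2), Thm 3, Thm 5 (the
variational equation of a minimiser, odd class).
-/

noncomputable section

set_option linter.dupNamespace false

open Complex Filter Set MeasureTheory
open scoped Real Topology ComplexConjugate

namespace Summit.RiemannHypothesis.RiemannHypothesis.Theorems.OddSector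

open Literature.NumberTheory.LFunctions
open Literature.NumberTheory.LFunctions.ConnesVanSuijlekom
open Summit.RiemannHypothesis.RiemannHypothesis.Theorems.GroundStatesConvergeToXi

/-! ### Polarisation of `Re Q` along a complex line -/

/-- **Expansion of `Re Q` along a complex line.** For test functions `v, g` and `μ : ℂ`,
`Re Q(v + μ g) = Re Q(v) + |μ|² Re Q(g) + 2 Re(μ · W(g ⋆ ṽ))` (bi-additivity of `Q`,
`weilQuadratic_add`; homogeneity `Q(μ g) = |μ|² Q(g)`; the cross terms are
`μ̄ W(v ⋆ g̃) + μ W(g ⋆ ṽ) = 2 Re(μ W(g ⋆ ṽ))` by the hermitian symmetry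
`W(v ⋆ g̃) = conj W(g ⋆ ṽ)`, `weilFunctional_weilConv_weilReflect_swap`).
[cite: Bombieri2000Weil, §3–§4 (the hermitian form attached to T)] -/
theorem re_weilQuadratic_add_const_mul {v g : ℝ → ℂ} (hv : IsWeilTest v) (hg : IsWeilTest g)
    (μ : ℂ) :
    (weilQuadratic (v + fun t => μ * g t)).re =
      (weilQuadratic v).re + ‖μ‖ ^ 2 * (weilQuadratic g).re +
        2 * (μ * weilFunctional (weilConv g (weilReflect v))).re := by
  rw [weilQuadratic_add hv (hg.const_mul μ), weilQuadratic_const_mul, weilReflect_const_mul,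
    weilConv_const_mul_right, weilConv_const_mul_left, weilFunctional_const_mul,
    weilFunctional_const_mul, weilFunctional_weilConv_weilReflect_swap g v, Complex.sq_norm]
  simp only [Complex.add_re, Complex.mul_re, Complex.ofReal_re, Complex.ofReal_im,
    Complex.conj_re, Complex.conj_im]
  ring

/-! ### Un-normalising the hypothesis on the orthogonal odd sphere -/

/-- **Un-normalised second level.** If `m₂ ≤ Re Q(h)` for every `L²`-normalised odd window test
`h` with `⟨h, u⟩ = ∫ h ū = 0`, then `m₂ ∫|w|² ≤ Re Q(w)` for every odd window test `w` with
`∫ w ū = 0` (homogeneity `Q(c w) = c² Q(w)` for real `c > 0`, and `Q(0) = 0` when `∫|w|² = 0`;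
`ConnesVanSuijlekom.mul_integral_le_re_of_sphere`). [folklore] -/
theorem mul_integral_norm_sq_le_re_of_orthogonal {a m₂ : ℝ} {u w : ℝ → ℂ}
    (H : ∀ h : ℝ → ℂ, IsWeilTest h → tsupport h ⊆ Icc (-a) a → (∀ t, h (-t) = -h t) →
      ∫ t, ‖h t‖ ^ 2 = (1 : ℝ) → ∫ t, h t * conj (u t) = 0 → m₂ ≤ (weilQuadratic h).re)
    (hw : IsWeilTest w) (hws : tsupport w ⊆ Icc (-a) a) (hwo : ∀ t, w (-t) = -w t)
    (horth : ∫ t, w t * conj (u t) = 0) :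
    m₂ * ∫ t, ‖w t‖ ^ 2 ≤ (weilQuadratic w).re := by
  refine mul_integral_le_re_of_sphere hw fun c _ hnorm => ?_
  refine H _ (hw.const_mul c) (tsupport_mul_subset_right.trans hws) (fun t => ?_) hnorm ?_
  · simp only [hwo, mul_neg]
  · show ∫ t, (c : ℂ) * w t * conj (u t) = 0
    have e : (fun t => (c : ℂ) * w t * conj (u t)) = fun t => (c : ℂ) * (w t * conj (u t)) := by
      funext t
      ring
    rw [e, integral_const_mul, horth, mul_zero]

/-! ### The limit passage -/

/-- **Limit bookkeeping of the two-level argument.** Let `μₙ → −p`, `Aₙ → ε p̄`, `Pₙ → p` in `ℂ`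
and `Qgₙ → ε` in `ℝ`, and suppose that eventually
`m₂ (1 + |μₙ|² + 2 Re(μ̄ₙ Pₙ)) ≤ Qv + |μₙ|² Qgₙ + 2 Re(μₙ Aₙ)`. Then
`(m₂ − ε)(1 − |p|²) ≤ Qv − ε` (pass to the limit: the left side tends to `m₂ (1 − |p|²)`, the
right side to `Qv − ε |p|²`). [folklore] -/
theorem twoLevel_limit {ε m₂ Qv : ℝ} {p : ℂ} {μ A P : ℕ → ℂ} {Qg : ℕ → ℝ}
    (hμ : Tendsto μ atTop (𝓝 (-p))) (hA : Tendsto A atTop (𝓝 ((ε : ℂ) * conj p)))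
    (hP : Tendsto P atTop (𝓝 p)) (hQ : Tendsto Qg atTop (𝓝 ε))
    (hstep : ∀ᶠ n in atTop, m₂ * (1 + ‖μ n‖ ^ 2 + 2 * (conj (μ n) * P n).re) ≤
      Qv + ‖μ n‖ ^ 2 * Qg n + 2 * (μ n * A n).re) :
    (m₂ - ε) * (1 - ‖p‖ ^ 2) ≤ Qv - ε := by
  have hn2 : Tendsto (fun n => ‖μ n‖ ^ 2) atTop (𝓝 (‖-p‖ ^ 2)) := (hμ.norm).pow 2
  rw [norm_neg] at hn2
  have h1 : Tendsto (fun n => (μ n * A n).re) atTop (𝓝 ((-p * ((ε : ℂ) * conj p)).re)) :=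
    (Complex.continuous_re.tendsto _).comp (hμ.mul hA)
  have h2 : Tendsto (fun n => (conj (μ n) * P n).re) atTop (𝓝 ((conj (-p) * p).re)) :=
    (Complex.continuous_re.tendsto _).comp (((Complex.continuous_conj.tendsto _).comp hμ).mul hP)
  have e1 : (-p * ((ε : ℂ) * conj p)).re = -(ε * ‖p‖ ^ 2) := by
    rw [Complex.sq_norm, Complex.normSq_apply]
    simp only [neg_mul, Complex.neg_re, Complex.mul_re, Complex.mul_im, Complex.ofReal_re,
      Complex.ofReal_im, Complex.conj_re, Complex.conj_im]
    ring
  have e2 : (conj (-p) * p).re = -‖p‖ ^ 2 := by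
    rw [Complex.sq_norm, Complex.normSq_apply]
    simp only [map_neg, neg_mul, Complex.neg_re, Complex.mul_re, Complex.conj_re, Complex.conj_im]
    ring
  have hF : Tendsto (fun n => (Qv + ‖μ n‖ ^ 2 * Qg n + 2 * (μ n * A n).re) -
      m₂ * (1 + ‖μ n‖ ^ 2 + 2 * (conj (μ n) * P n).re)) atTop
      (𝓝 ((Qv + ‖p‖ ^ 2 * ε + 2 * (-p * ((ε : ℂ) * conj p)).re) -
        m₂ * (1 + ‖p‖ ^ 2 + 2 * (conj (-p) * p).re))) :=
    ((tendsto_const_nhds.add (hn2.mul hQ)).add (h1.const_mul 2)).sub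
      (((tendsto_const_nhds.add hn2).add (h2.const_mul 2)).const_mul m₂)
  have hlim : 0 ≤ (Qv + ‖p‖ ^ 2 * ε + 2 * (-p * ((ε : ℂ) * conj p)).re) -
      m₂ * (1 + ‖p‖ ^ 2 + 2 * (conj (-p) * p).re) :=
    ge_of_tendsto hF (hstep.mono fun n hn => sub_nonneg.2 hn)
  rw [e1, e2] at hlim
  nlinarith [hlim]

/-! ### Two-level proximity -/

/-- **Two-level proximity for an odd-sector ground state** (curried form, pairing `∫ v ū`).
Let `u` be an odd-sector ground state at window `a` (`ε₁ = weilOddGroundEnergy a`) and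
`m₂ > ε₁` a lower bound for `Re Q` on the `L²`-normalised smooth odd window tests orthogonal to
`u`. Then every normalised smooth odd window test `v` satisfies
`1 − |∫ v ū|² ≤ (Re Q(v) − ε₁)/(m₂ − ε₁)`. Proof: along the odd minimising sequence `gₙ → u`
with the weak Euler–Lagrange identity (`IsWeilOddGroundState.exists_eulerLagrange`), the tests
`wₙ = v − (p/cₙ) gₙ` (`p = ∫ v ū`, `cₙ = ∫ gₙ ū → 1`) are exactly orthogonal to `u`; expand
`Re Q(wₙ) ≥ m₂ ∫|wₙ|²` by polarisation and let `n → ∞` (`twoLevel_limit`).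
[cite: Bombieri2000Weil, §4 Lemma 1 / (4.2), Thm 3 and Thm 5] -/
theorem twoLevelProximity {a : ℝ} {u : ℝ → ℂ} (hu : IsWeilOddGroundState a u) {m₂ : ℝ}
    (hm : weilOddGroundEnergy a < m₂)
    (H : ∀ h : ℝ → ℂ, IsWeilTest h → tsupport h ⊆ Icc (-a) a → (∀ t, h (-t) = -h t) →
      ∫ t, ‖h t‖ ^ 2 = (1 : ℝ) → ∫ t, h t * conj (u t) = 0 → m₂ ≤ (weilQuadratic h).re)
    {v : ℝ → ℂ} (hv : IsWeilTest v) (hvs : tsupport v ⊆ Icc (-a) a) (hvo : ∀ t, v (-t) = -v t)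
    (hv1 : ∫ t, ‖v t‖ ^ 2 = (1 : ℝ)) :
    1 - ‖∫ t, v t * conj (u t)‖ ^ 2 ≤
      ((weilQuadratic v).re - weilOddGroundEnergy a) / (m₂ - weilOddGroundEnergy a) := by
  obtain ⟨g, hg, hQ, hL, hEL⟩ := hu.exists_eulerLagrange
  have hum : MemLp u 2 := hu.memLp
  have hvm : MemLp v 2 := isWeilTest_memLp hv
  have hgm : ∀ n, MemLp (g n) 2 := fun n => isWeilTest_memLp (hg n).1
  -- `cₙ = ⟨gₙ, u⟩ → ⟨u, u⟩ = 1`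
  have hc1 : Tendsto (fun n => ∫ t, g n t * conj (u t)) atTop (𝓝 1) := by
    have h1 := tendsto_integral_mul_conj_left hum hum hgm hL
    rw [integral_mul_conj_self u, hu.integral_norm_sq, Complex.ofReal_one] at h1
    exact h1
  set p : ℂ := ∫ t, v t * conj (u t) with hp
  set c : ℕ → ℂ := fun n => ∫ t, g n t * conj (u t) with hc
  -- `⟨v, gₙ⟩ → ⟨v, u⟩ = p`
  have hPp : Tendsto (fun n => ∫ t, v t * conj (g n t)) atTop (𝓝 p) :=
    tendsto_integral_mul_conj hvm hum hgm hL
  -- `W(gₙ ⋆ ṽ) → ε₁ ∫ u v̄ = ε₁ p̄` (weak Euler–Lagrange)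
  have hconjp : ∫ t, u t * conj (v t) = conj p := by
    rw [hp, ← integral_conj]
    refine integral_congr_ae (Eventually.of_forall fun t => ?_)
    simp only [map_mul, Complex.conj_conj]
    exact mul_comm _ _
  have hAp : Tendsto (fun n => weilFunctional (weilConv (g n) (weilReflect v))) atTop
      (𝓝 ((weilOddGroundEnergy a : ℂ) * conj p)) := by
    rw [← hconjp]
    exact hEL v hv hvs
  -- `μₙ = -p / cₙ → -p`
  have hμ : Tendsto (fun n => -(p / c n)) atTop (𝓝 (-p)) := by
    have h1 : Tendsto (fun n => p / c n) atTop (𝓝 (p / 1)) :=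
      Filter.Tendsto.div tendsto_const_nhds hc1 one_ne_zero
    rw [div_one] at h1
    exact h1.neg
  -- the second level applied to `wₙ = v + μₙ gₙ ⊥ u`, expanded by polarisation
  have hstep : ∀ᶠ n in atTop,
      m₂ * (1 + ‖-(p / c n)‖ ^ 2 + 2 * (conj (-(p / c n)) * ∫ t, v t * conj (g n t)).re) ≤
        (weilQuadratic v).re + ‖-(p / c n)‖ ^ 2 * (weilQuadratic (g n)).re +
          2 * (-(p / c n) * weilFunctional (weilConv (g n) (weilReflect v))).re := by
    filter_upwards [hc1.eventually_ne one_ne_zero] with n hn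
    have hwt : IsWeilTest (v + fun t => -(p / c n) * g n t) := hv.add ((hg n).1.const_mul _)
    have hws : tsupport (v + fun t => -(p / c n) * g n t) ⊆ Icc (-a) a :=
      (tsupport_add _ _).trans (union_subset hvs (tsupport_mul_subset_right.trans (hg n).2.1))
    have hwo : ∀ t, (v + fun t => -(p / c n) * g n t) (-t) =
        -(v + fun t => -(p / c n) * g n t) t := fun t => by
      simp only [Pi.add_apply, hvo, (hg n).2.2.1]
      ring
    have horth : ∫ t, (v + fun t => -(p / c n) * g n t) t * conj (u t) = 0 := by
      have e1 : (fun t => (v + fun t => -(p / c n) * g n t) t * conj (u t)) =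
          fun t => v t * conj (u t) + -(p / c n) * (g n t * conj (u t)) := by
        funext t
        simp only [Pi.add_apply]
        ring
      have i1 : Integrable fun t => v t * conj (u t) := hvm.integrable_mul (memLp_conj hum)
      have i2 : Integrable fun t => -(p / c n) * (g n t * conj (u t)) :=
        ((hgm n).integrable_mul (memLp_conj hum)).const_mul (-(p / c n))
      rw [e1, integral_add i1 i2, integral_const_mul]
      change p + -(p / c n) * c n = 0
      rw [neg_mul, div_mul_cancel₀ p hn, add_neg_cancel]
    have h1 := mul_integral_norm_sq_le_re_of_orthogonal H hwt hws hwo horth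
    rw [re_weilQuadratic_add_const_mul hv (hg n).1 (-(p / c n))] at h1
    have e2 : ∫ t, ‖(v + fun t => -(p / c n) * g n t) t‖ ^ 2 =
        1 + ‖-(p / c n)‖ ^ 2 + 2 * (conj (-(p / c n)) * ∫ t, v t * conj (g n t)).re := by
      have h2 := integral_norm_sq_add_mul hvm (hgm n) (-(p / c n))
      rw [hv1, (hg n).2.2.2, mul_one, Complex.normSq_eq_norm_sq] at h2
      simpa only [Pi.add_apply] using h2
    rw [e2] at h1
    exact h1
  rw [le_div_iff₀ (sub_pos.2 hm), mul_comm]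
  exact twoLevel_limit hμ hAp hPp hQ hstep

/-- **Stub P1 — two-level proximity (RH-free).** If `u` is an odd-sector ground state at window
`a` (energy `ε₁ = weilOddGroundEnergy a`) and every `L²`-normalised smooth odd window test
orthogonal to `u` has `Re Q ≥ m₂ > ε₁`, then every normalised smooth odd window test `v` satisfies
`1 − |⟨u, v⟩|² ≤ (Re Q(v) − ε₁)/(m₂ − ε₁)`. (Write `v = c gₙ + wₙ` with `wₙ ⊥ u` exactly along
the odd minimising sequence `gₙ → u`; the odd weak Euler–Lagrange identity kills the cross term in
the limit.) Registered uncurried form of `twoLevelProximity` (pairing written `∫ ū v = ∫ v ū`).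
[cite: Bombieri2000Weil, §4 Lemma 1 / (4.2), Thm 3 and Thm 5] -/
theorem stub_twoLevelProximity :
    ∀ (a : ℝ) (u : ℝ → ℂ), IsWeilOddGroundState a u →
      ∀ m₂ : ℝ, weilOddGroundEnergy a < m₂ →
        (∀ h : ℝ → ℂ, IsWeilTest h → tsupport h ⊆ Icc (-a) a → (∀ t, h (-t) = -h t) →
          ∫ t, ‖h t‖ ^ 2 = (1 : ℝ) → ∫ t, (starRingEnd ℂ) (u t) * h t = 0 →
            m₂ ≤ (weilQuadratic h).re) →
        ∀ v : ℝ → ℂ, IsWeilTest v → tsupport v ⊆ Icc (-a) a → (∀ t, v (-t) = -v t) →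
          ∫ t, ‖v t‖ ^ 2 = (1 : ℝ) →
            1 - ‖∫ t, (starRingEnd ℂ) (u t) * v t‖ ^ 2 ≤
              ((weilQuadratic v).re - weilOddGroundEnergy a) / (m₂ - weilOddGroundEnergy a) := by
  intro a u hu m₂ hm H v hv hvs hvo hv1
  have hcomm : ∀ h : ℝ → ℂ, ∫ t, (starRingEnd ℂ) (u t) * h t = ∫ t, h t * (starRingEnd ℂ) (u t) :=
    fun h => integral_congr_ae (Eventually.of_forall fun t => mul_comm _ _)
  rw [hcomm v]
  exact twoLevelProximity hu hm
    (fun h hh hhs hho hh1 hh0 => H h hh hhs hho hh1 ((hcomm h).trans hh0)) hv hvs hvo hv1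

end Summit.RiemannHypothesis.RiemannHypothesis.Theorems.OddSector

end
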